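import Mathlib.Order.Filter.AtTopBot.Basic
import Mathlib.Topology.Order.Basic
import Mathlib.NumberTheory.Padics.PadicVal.Basic
import Mathlib.NumberTheory.Padics.PadicNumbers
import Mathlib.Algebra.Squarefree.Basic
import Literature.NumberTheory.EllipticCurves.Selmer
import Literature.NumberTheory.EllipticCurves.RootNumber
import Literature.NumberTheory.EllipticCurves.TateModule
import Literature.NumberTheory.EllipticCurves.Isogeny
import Literature.NumberTheory.EllipticCurves.QuadraticTwist
import Literature.NumberTheory.EllipticCurves.HeightFamily
import Literature.NumberTheory.EllipticCurves.AnalyticRank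
import Literature.NumberTheory.EllipticCurves.GaloisAction
import Literature.NumberTheory.EllipticCurves.MordellWeil
import Literature.NumberTheory.EllipticCurves.Sha
import Literature.NumberTheory.EllipticCurves.GlobalMinimalModel
import Literature.NumberTheory.EllipticCurves.Tamagawa
import Literature.NumberTheory.EllipticCurves.PAdicHeights
import Literature.NumberTheory.DiophantineGeometry.LocalReduction
import Literature.NumberTheory.GaloisRepresentations.IntegralGaloisAction
import HarnessLib

-- D-0014 sorry-sweep (operator, 2026-08-13): sorried theorems -> named facts `def X : Prop`; partial proofs preserved in comments
-- provenance: harness21/H21/H21/Statements/BSD/Selmer.lean @ 76baec2 (interim HEAD d8f2665); M5 mechanical rewrite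
/-!
# BSD family: Selmer-group statements

Family `bsd`, trunk T-ELLARITH-M (group G16, work item `BSDSelmerStatements`). Target statements:

* **bsd.S11** — the `n`-Selmer group `Sel^(n)(E/K)` and the `p^∞`-Selmer group via local
  conditions, the fundamental exact sequence `0 → E(K)/nE(K) → Sel^(n)(E/K) → Ш(E/K)[n] → 0`, and
  `corank Sel_{p^∞} = rank E(K) + corank Ш[p^∞]` (Silverman, *AEC*, X.4.2):
  `selmerGroup_def`, `selmer_exact`, `map_torsionH1ToH1_selmerGroup`, `selmerCorank_eq`.
* **bsd.S19** — the `p`-parity theorem (T. Dokchitser–V. Dokchitser, Ann. of Math. 172 (2010),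
  Thm 1.4, Cor. 4.20): `(-1)^{corank Sel_{p^∞}(E/ℚ)} = w(E)` and
  `corank Sel_{p^∞}(E/ℚ) ≡ ord_{s=1} L(E,s) (mod 2)`: `p_parity`, `selmerCorank_mod_two_eq`.
* **bsd.S25** — `p`-converse theorems to Gross–Zagier–Kolyvagin in rank / corank one: Skinner,
  Ann. of Math. 191 (2020), Thm A′ (`skinner_analyticRank_eq_one_of_mordellWeilRank_eq_one`);
  Burungale–Skinner–Tian–Wan, arXiv:2409.01350, Thm 1.10
  (`burungaleSkinnerTianWan_analyticRank_eq_one_of_selmerCorank_eq_one`); C.-H. Kim, Math. Ann.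
  387 (2022), Cor. 1.4 (`kim_analyticRank_eq_one_of_mordellWeilRank_eq_one`); and the interim
  statement `analyticRank_eq_one_of_selmerCorank_eq_one` (kept verbatim; a corollary of the
  Burungale–Skinner–Tian–Wan fact, proved: `analyticRank_eq_one_of_selmerCorank_eq_one_of_bstw`).
* **bsd.S26** — Bhargava–Shankar (Ann. of Math. 181 (2015), Thm 1.1): the average size of the
  `2`-Selmer group is `3`: `average_card_selmerTwo`, `heightAverageLE_card_selmerTwo`.
* **bsd.S34** — Smith (arXiv:2503.17619, Thm 1.1, Cor. 1.3): distribution of `2^∞`-Selmer coranks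
  in quadratic twist families: `twistDensity`, `selmerCorankTwoInfty`,
  `smith_selmerCorank_density`, `smith_rank_of_rootNumber`.

## Mathlib / H21 reuse

All arithmetic objects come from the accepted preludes: `WeierstrassCurve.selmerGroup`,
`selmerGroupPInfty`, `selmerCorank`, `shaCorank`, `torsionH1ToH1`, `Literature.NumberTheory.EllipticCurves.zpCorank`
(`Literature.Prelude.EllArithM.Selmer`); `WeierstrassCurve.rootNumber` (the sign of the functional
equation of an *entire* continuation of the completed L-function, `Prelude.EllArithM.RootNumber`);
`analyticRank`, `mordellWeilRank`, `sha`, `quadraticTwist`, `frobeniusTrace`,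
`minimalDiscriminantInt`, `HasSurjectiveModNGaloisRep`, `HasIrreducibleModPGaloisRep`, `HasCM`,
`HasGoodReductionAtPrime`, `HasMultiplicativeReductionAtPrime` (G06 preludes),
`HasSplitMultiplicativeReductionAtPrime` (`PAdicHeights`), `IsSemistable` (`LocalReduction`); the
height family `Literature.NumberTheory.EllipticCurves.shortWeierstrass`,
`Literature.NumberTheory.EllipticCurves.heightAverage`, `Literature.NumberTheory.EllipticCurves.HeightAverageLE` (`Prelude.TranscendEllArithS.HeightFamily`, which
re-exports the Wave0 names verbatim; `Literature.Statements.BSD.Wave0` is deliberately **not** imported).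
Mathlib: `Squarefree`, `Nat.card`, `Filter.Tendsto`, `padicValInt`, `Padic` (`ℚ_[p]`),
`AddCommGroup.primaryComponent`. Mathlib has no Selmer group of an elliptic curve (its
`IsDedekindDomain.HeightOneSpectrum.selmerGroup` is the Selmer group of a number field) and no
natural density over squarefree integers (searched `squarefree.*density`, `naturalDensity`); the
small glue `twistDensity` is defined here.

## Design choices

* `noncomputable section`, `open scoped Classical`; `namespace Literature.BSD`. Two auxiliary pieces of
  glue needed by bsd.S25 (`primaryPointsMap`, `selmerLocalKerPrimaryTorsion`: the local
  restriction `H¹(K, E[p^∞]) → H¹(K_v, E[p^∞])`, as opposed to the prelude's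
  `selmerLocalKerPrimary` whose target is `H¹(K_v, E)`) also live in `Literature.BSD`.
* Statements over a general number field keep the prelude's universe discipline
  (`K : Type u`); statements over `ℚ` are universe-free.
* bsd.S25 (source check, 2026-08-14, against the held texts arXiv:1405.7294 = Ann. of Math. 191
  (2020), arXiv:2409.01350, doi:10.1007/s00208-022-02511-8, doi:10.4310/CJM.2014.v2.n2.a2): the
  interim docstring of `analyticRank_eq_one_of_selmerCorank_eq_one` attributed its hypothesis
  list to "Skinner 2020, Thm A"; Skinner's printed theorems (A, A′, B, C) all require squarefree
  conductor and say something else (see that docstring). The interim Lean statement is kept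
  byte-for-byte (D-0014: meanings are never edited in place) and re-sourced; the printed
  statements are vendored next to it under new names, one source each, hypotheses transcribed
  item by item. "`ρ̄_{E,p}` ramified at a prime `ℓ ‖ N`" is transcribed throughout this family
  (bsd.S21, bsd.S30) in Tate-curve form: multiplicative reduction at `ℓ ≠ p` and
  `p ∤ v_ℓ(Δ_min)`.
* bsd.S34: `quadraticTwist d` is elliptic only for `d ≠ 0`; `Squarefree d` already excludes
  `d = 0` (`not_squarefree_zero`), and the predicates quantify `d ≠ 0` explicitly anyway.
-/

noncomputable section

open scoped Classical
open scoped AddSubgroup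

open Filter Topology NumberField IsDedekindDomain WeierstrassCurve

universe u

namespace Literature.NumberTheory.EllipticCurves

/-! ## bsd.S11 — Selmer groups and the fundamental exact sequence -/

section S11

variable {K : Type u} [Field K] [NumberField K] (W : WeierstrassCurve K)

/-- **bsd.S11** (definition of the `n`-Selmer group; Silverman, *AEC*, X.§4, Def. before X.4.2;
Milne, *ADT*, I.§6). `Sel^(n)(E/K) ⊆ H¹(K, E[n])` is the subgroup of classes whose image in
`H¹(K_v, E)` vanishes at every finite place `v` (`K_v = v.adicCompletion K`) and every infinite
place `w` (`K_w = w.Completion`); restatement (`rfl`) of `WeierstrassCurve.selmerGroup`. [folklore] -/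
theorem selmerGroup_def (n : ℤ) :
    W.selmerGroup n =
      (⨅ v : HeightOneSpectrum (𝓞 K), W.selmerLocalKer (v.adicCompletion K) n) ⊓
        ⨅ w : InfinitePlace K, W.selmerLocalKer w.Completion n :=
  rfl

/-- **bsd.S11** (surjectivity half of the fundamental exact sequence; Silverman, *AEC*, X.4.2(a)).
For `n ≠ 0` the image of `Sel^(n)(E/K)` under `H¹(K, E[n]) → H¹(K, E)` is `Ш(E/K)[n]`
(restatement of the prelude theorem `WeierstrassCurve.map_torsionH1ToH1_selmerGroup`). [cite: SilvermanAEC2009, Thm. X.4.2(a); GreenbergLNM1716, §1 (exact sequence `0 → E(M) ⊗ ℚ/ℤ → Sel_E(M) → Ш_E(M) → 0`, PDF p. 59 of the volume)] -/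
def map_torsionH1ToH1_selmerGroup : Prop :=
  ∀ {n : ℤ} (hn : n ≠ 0),
    (W.selmerGroup n).map (W.torsionH1ToH1 n) = W.sha ⊓ AddSubgroup.torsionBy W.galH1 n

/- interim proof relied on results that are now named facts (D-0014); demoted to a fact by the D-0014 sorry-sweep, proof preserved:
:=
  WeierstrassCurve.map_torsionH1ToH1_selmerGroup W hn
-/

/-- **bsd.S11** (the fundamental exact sequence `0 → E(K)/nE(K) → Sel^(n)(E/K) → Ш(E/K)[n] → 0`;
Silverman, *AEC*, X.4.2(a); Milne, *ADT*, I.§6). For an elliptic curve `E/K` over a number field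
and `n ≠ 0` there is a (Kummer) homomorphism `κ : E(K) → H¹(K, E[n])` with kernel `nE(K)` whose
image is exactly `Sel^(n)(E/K) ∩ ker (H¹(K, E[n]) → H¹(K, E))`, and `H¹(K, E[n]) → H¹(K, E)` maps
`Sel^(n)(E/K)` onto `Ш(E/K)[n]`; together these say that the displayed sequence is exact. [cite: SilvermanAEC2009, Thm. X.4.2(a); GreenbergLNM1716, §1 (exact sequence `0 → E(M) ⊗ ℚ/ℤ → Sel_E(M) → Ш_E(M) → 0`, PDF p. 59 of the volume)] -/
def selmer_exact : Prop :=
  ∀ (n : ℤ) (hn : n ≠ 0),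
    ∃ κ : W.toAffine.Point →+ W.galH1Torsion n,
      κ.ker = (zsmulAddGroupHom (α := W.toAffine.Point) n).range ∧
        κ.range = W.selmerGroup n ⊓ (W.torsionH1ToH1 n).ker ∧
          (W.selmerGroup n).map (W.torsionH1ToH1 n) = W.sha ⊓ AddSubgroup.torsionBy W.galH1 n

/- interim proof relied on results that are now named facts (D-0014); demoted to a fact by the D-0014 sorry-sweep, proof preserved:
:= by
  obtain ⟨κ, h₁, h₂⟩ := W.exists_kummerMap hn
  exact ⟨κ, h₁, h₂, W.map_torsionH1ToH1_selmerGroup hn⟩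
-/

/-- **bsd.S11** (corank identity; Silverman, *AEC*, X.4.2 with Greenberg (1999), *Iwasawa theory
for elliptic curves*, §1, p. 53; Milne, *ADT*, I.§6). For an elliptic curve `E` over a number field
`K` and a prime `p`, `corank_{ℤ_p} Sel_{p^∞}(E/K) = rank E(K) + corank_{ℤ_p} Ш(E/K)[p^∞]`, from
`0 → E(K) ⊗ ℚ_p/ℤ_p → Sel_{p^∞}(E/K) → Ш(E/K)[p^∞] → 0`. [cite: Greenberg1999] -/
def selmerCorank_eq : Prop :=
  ∀ [W.IsElliptic] (p : ℕ) [Fact p.Prime],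
    W.selmerCorank p = W.mordellWeilRank + W.shaCorank p

/- interim proof relied on results that are now named facts (D-0014); demoted to a fact by the D-0014 sorry-sweep, proof preserved:
:=
  W.selmerCorank_eq_mordellWeilRank_add p
-/

end S11

/-! ## bsd.S19 — the `p`-parity theorem -/

section S19

variable (W : WeierstrassCurve ℚ) [W.IsElliptic] (p : ℕ) [Fact p.Prime]

/-- **bsd.S19** (the `p`-parity theorem; T. Dokchitser and V. Dokchitser, *On the
Birch–Swinnerton-Dyer quotients modulo squares*, Ann. of Math. 172 (2010), Thm 1.4 (with
Cor. 4.20 for the remaining potentially supersingular cases at `p = 2, 3`)). For every elliptic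
curve `E/ℚ` and every prime `p`, `(-1)^{corank_{ℤ_p} Sel_{p^∞}(E/ℚ)} = w(E/ℚ)`, the global root
number (`WeierstrassCurve.rootNumber`, the sign of the functional equation of the entire completed
L-function, genuinely `±1`-valued). Printed form (arXiv:math/0610290 = Ann. of Math. 172 (2010), Thm 1.4): "Conjecture 1.2 [the `p`-parity conjecture: `rk_p(E/K)` is even iff `w(E/K) = 1`] holds for all `E/ℚ` and all primes `p`." [cite: DokchitserDokchitserAnnals2010, Thm. 1.4] -/
def p_parity : Prop :=
  (-1 : ℤ) ^ W.selmerCorank p = W.rootNumber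

/-- **bsd.S19** (the `p`-parity theorem, analytic form; Dokchitser–Dokchitser, Ann. of Math. 172
(2010), Thm 1.4 and Cor. 4.20, combined with `w(E) = (-1)^{ord_{s=1} L(E,s)}` from the functional
equation). For every elliptic curve `E/ℚ` and every prime `p`,
`corank_{ℤ_p} Sel_{p^∞}(E/ℚ) ≡ ord_{s=1} L(E,s) (mod 2)`. [cite: DokchitserDokchitserAnnals2010, Thm. 1.4 (combined with `w(E) = (-1)^{ord_{s=1} L(E,s)}` from the functional equation of the entire `L`-function)] -/
def selmerCorank_mod_two_eq : Prop :=
  W.selmerCorank p % 2 = W.analyticRank % 2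

end S19

/-! ## bsd.S25 — `p`-converse theorems to Gross–Zagier–Kolyvagin in (co)rank one -/

section S25

variable {K : Type u} [Field K] (W : WeierstrassCurve K) (E : Type u) [Field E] [Algebra K E]
  (p : ℕ)

/-- The map `E(K̄)[p^∞] → E(K̄_E)[p^∞]` on `p`-primary torsion induced by the map on points
`pointsMap W E : E(K̄) → E(K̄_E)` of the chosen embedding `K̄ → K̄_E` (a homomorphism sends
`p`-power torsion to `p`-power torsion). Glue for the local restriction at `p` in Skinner's
theorem. Silverman, *AEC*, X.§4; Greenberg (1999), §2. [cite: Greenberg1999] -/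
def primaryPointsMap :
    W.geomPrimaryTorsion p →+ AddCommGroup.primaryComponent (localPoints W E) p :=
  ((pointsMap W E).comp (W.geomPrimaryTorsion p).subtype).codRestrict
    (AddCommGroup.primaryComponent (localPoints W E) p) fun P ↦ by
      obtain ⟨k, hk⟩ := (AddCommGroup.mem_primaryComponent).1 P.2
      refine (AddCommGroup.mem_primaryComponent).2 ⟨k, ?_⟩
      rw [← map_nsmul, AddMonoidHom.coe_comp, AddSubgroup.coe_subtype, Function.comp_apply,
        AddSubgroup.coe_nsmul, hk, map_zero]

/-- Equivariance of `primaryPointsMap` along `resGal E`: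
`primaryPointsMap (resGal σ • P) = σ • primaryPointsMap P` (from `pointsMap_smul`).
Serre, *Galois Cohomology*, I.§2.4. [folklore] -/
theorem primaryPointsMap_smul (σ : Field.absoluteGaloisGroup E) (P : W.geomPrimaryTorsion p) :
    primaryPointsMap W E p (resGal (K := K) E σ • P) = σ • primaryPointsMap W E p P := by
  apply Subtype.ext
  simp only [primaryPointsMap, AddMonoidHom.codRestrict_apply, AddMonoidHom.coe_comp,
    AddSubgroup.coe_subtype, Function.comp_apply, Literature.NumberTheory.EllipticCurves.primaryComponent.coe_smul]
  exact pointsMap_smul W E σ P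

/-- The kernel of the local restriction `H¹(K, E[p^∞]) → H¹(E, E(K̄_E)[p^∞])` at a `K`-field `E`
(a completion `K_v`), induced by the compatible pair `(resGal E, primaryPointsMap)`. For `E = ℚ_p`
its intersection with `Sel_{p^∞}(E/ℚ)` is the kernel of the localisation
`loc_p : Sel_{p^∞}(E/ℚ) → E(ℚ_p) ⊗ ℚ_p/ℤ_p ⊆ H¹(ℚ_p, E[p^∞])` appearing in Skinner's Theorem A.
Greenberg (1999), §2; Skinner, Ann. of Math. 191 (2020), §1. [cite: Greenberg1999] -/
def selmerLocalKerPrimaryTorsion : AddSubgroup (W.galH1Primary p) :=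
  resKer (resGal (K := K) E) (primaryPointsMap W E p) (primaryPointsMap_smul W E p)

/-- **bsd.S25** (interim statement, kept verbatim; re-sourced 2026-08-14). For an elliptic curve
`E/ℚ` with globally minimal model `W` and a prime `p ≥ 5` such that `E` has good ordinary
reduction at `p` (`hgood`, `hord : p ∤ a_p`), `ρ̄_{E,p}` is surjective (`hsurj`), there is a prime
`ℓ ≠ p` of multiplicative reduction with `p ∤ v_ℓ(Δ_min)` (`haux`, i.e. `ℓ ‖ N` and `ρ̄_{E,p}`
ramified at `ℓ`), and the subgroup of `Sel_{p^∞}(E/ℚ)` dying in `H¹(ℚ_p, E[p^∞])` is finite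
(`hloc`): `corank_{ℤ_p} Sel_{p^∞}(E/ℚ) = 1 ⇒ ord_{s=1} L(E,s) = 1`.

**Source check.** The interim docstring presented this hypothesis list as an item-by-item
transcription of "C. Skinner, *A converse to a theorem of Gross, Zagier, and Kolyvagin*, Ann. of
Math. 191 (2020), Theorem A". It is not: Skinner's Theorem A concerns newforms `f ∈ S₂(Γ₀(N))`
with `N` **squarefree** and concludes `rank A_f(ℚ) = [M_f:ℚ] ∧ #Ш(A_f) < ∞ ⇒ ord_{s=1} L(f,s) = 1`
under a local condition (some odd `ℓ` with `π_ℓ` the unramified quadratic twist of the special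
representation, or two odd primes with `π_ℓ` special); Theorem A′ is its elliptic-curve form
(vendored below as `skinner_analyticRank_eq_one_of_mordellWeilRank_eq_one`); Theorem B is a
criterion over an imaginary quadratic field `K` (`dim_L H¹_f(K,V) = 1` and injectivity of the
restriction at the primes above `p`, again `N` squarefree, `p ≥ 5`); Theorem C is a `p`-Selmer
criterion for *semistable* curves. No theorem of that paper treats `Sel_{p^∞}(E/ℚ)` for `E` of
arbitrary conductor (cf. W. Zhang, Camb. J. Math. 2 (2014), p. 199: "first proved by Skinner for
square-free `N` with some mild restriction"). The statement below **is** a theorem in print: it is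
a weakening (extra hypotheses `5 ≤ p` instead of `p` odd, and `hloc`) of Burungale–Skinner–Tian–Wan,
*Zeta elements for elliptic curves and applications*, arXiv:2409.01350, **Thm 1.10** (vendored below
as `burungaleSkinnerTianWan_analyticRank_eq_one_of_selmerCorank_eq_one`; the deduction is the
proved `analyticRank_eq_one_of_selmerCorank_eq_one_of_bstw`). Milder hypotheses, cited not merged:
C.-H. Kim, Math. Ann. 387 (2022), Cor. 1.2 (non-CM, `p > 3` good ordinary, `E[p]` irreducible,
corank one and `res_p : Sel(ℚ,V) → E(ℚ_p) ⊗ ℚ_p` an isomorphism) and Cor. 1.4 (vendored below as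
`kim_analyticRank_eq_one_of_mordellWeilRank_eq_one`); Burungale–Castella–Skinner, IMRN 2025, §1.2
(remark after Thm 1.2.2: `p > 3` good ordinary, `E[p]` irreducible). [cite: BurungaleSkinnerTianWan2024, Thm. 1.10 (a weakening thereof)] -/
def analyticRank_eq_one_of_selmerCorank_eq_one : Prop :=
  ∀ (W : WeierstrassCurve ℚ) [W.IsElliptic] [W.IsGloballyMinimal] (p : ℕ) [Fact p.Prime] (hp : 5 ≤ p) (hgood : W.HasGoodReductionAtPrime p) (hord : ¬ (p : ℤ) ∣ W.frobeniusTrace p) (hsurj : W.HasSurjectiveModNGaloisRep p) (haux : ∃ ℓ : ℕ, ∃ _ : Fact ℓ.Prime, ℓ ≠ p ∧ W.HasMultiplicativeReductionAtPrime ℓ ∧ ¬ p ∣ padicValInt ℓ W.minimalDiscriminantInt) (hloc : Finite ↥(W.selmerGroupPInfty p ⊓ selmerLocalKerPrimaryTorsion W ℚ_[p] p)) (h : W.selmerCorank p = 1),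
    W.analyticRank = 1

/-- **bsd.S25** (C. Skinner, *A converse to a theorem of Gross, Zagier, and Kolyvagin*, Ann. of
Math. 191 (2020), 329–354 = arXiv:1405.7294, **Theorem A′** (introduction), the elliptic-curve form
of Theorem A via modularity). Printed statement: "Suppose `E` is a semistable elliptic curve over
`ℚ`. If there is at least one odd prime at which `E` has nonsplit multiplicative reduction or at
least two odd primes at which `E` has split multiplicative reduction, then
`rank_ℤ E(ℚ) = 1` and `#Ш(E) < ∞ ⟹ ord_{s=1} L(E,s) = 1`."
Transcription: semistable = `W.IsSemistable (𝓞 ℚ)` (good or multiplicative reduction at every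
finite place); nonsplit multiplicative at `ℓ` = multiplicative and not split multiplicative
(`HasMultiplicativeReductionAtPrime`, `HasSplitMultiplicativeReductionAtPrime`); odd = `ℓ ≠ 2`; the
two odd primes are distinct; `rank_ℤ E(ℚ) = W.mordellWeilRank`; `#Ш(E) < ∞ = Finite W.sha`;
`ord_{s=1} L(E,s) = W.analyticRank`. [cite: Skinner2020, Thm. A′] -/
def skinner_analyticRank_eq_one_of_mordellWeilRank_eq_one : Prop :=
  ∀ (W : WeierstrassCurve ℚ) [W.IsElliptic] (hss : W.IsSemistable (𝓞 ℚ))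
    (hred : (∃ ℓ : ℕ, ∃ _ : Fact ℓ.Prime, ℓ ≠ 2 ∧ W.HasMultiplicativeReductionAtPrime ℓ ∧
        ¬ W.HasSplitMultiplicativeReductionAtPrime ℓ) ∨
      (∃ ℓ₁ ℓ₂ : ℕ, ∃ _ : Fact ℓ₁.Prime, ∃ _ : Fact ℓ₂.Prime, ℓ₁ ≠ 2 ∧ ℓ₂ ≠ 2 ∧ ℓ₁ ≠ ℓ₂ ∧
        W.HasSplitMultiplicativeReductionAtPrime ℓ₁ ∧ W.HasSplitMultiplicativeReductionAtPrime ℓ₂))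
    (hrank : W.mordellWeilRank = 1) (hsha : Finite W.sha),
    W.analyticRank = 1

/-- **bsd.S25** (A. Burungale, C. Skinner, Y. Tian, X. Wan, *Zeta elements for elliptic curves and
applications*, arXiv:2409.01350 (2024), **Theorem 1.10**). Printed statement: "Let `E/ℚ` be an
elliptic curve of conductor `N`, and `p ∤ 2N` an ordinary prime. Suppose that the following holds.
(sur_ℚ) The mod `p` Galois representation `ρ̄ : G_ℚ → Aut_{𝔽_p} E[p]` is surjective.
(ram) There exists a prime `ℓ ‖ N` such that `ρ̄` is ramified at `ℓ`.
Then `corank_{ℤ_p} Sel_{p^∞}(E/ℚ) = 1 ⟹ ord_{s=1} L(s, E/ℚ) = 1`."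
Transcription (for the globally minimal model `W` of `E`): `p ∤ 2N` ordinary = `p ≠ 2`, good
reduction at `p` (`hgood`) and `p ∤ a_p(E)` (`hord`, `frobeniusTrace`); (sur_ℚ) = `hsurj`;
(ram) = `hram` in the Tate-curve form of bsd.S21/S30 (`ℓ ‖ N` iff multiplicative reduction at
`ℓ`; for such `ℓ ≠ p`, `ρ̄_{E,p}` is ramified at `ℓ` iff `p ∤ v_ℓ(Δ_min)`; `ℓ ≠ p` is automatic
since `p` is a good prime and is kept only to match `haux` of the interim statement);
corank = `W.selmerCorank p`; conclusion `W.analyticRank = 1`. [cite: BurungaleSkinnerTianWan2024, Thm. 1.10] -/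
def burungaleSkinnerTianWan_analyticRank_eq_one_of_selmerCorank_eq_one : Prop :=
  ∀ (W : WeierstrassCurve ℚ) [W.IsElliptic] [W.IsGloballyMinimal] (p : ℕ) [Fact p.Prime]
    (hp : p ≠ 2) (hgood : W.HasGoodReductionAtPrime p) (hord : ¬ (p : ℤ) ∣ W.frobeniusTrace p)
    (hsurj : W.HasSurjectiveModNGaloisRep p)
    (hram : ∃ ℓ : ℕ, ∃ _ : Fact ℓ.Prime, ℓ ≠ p ∧ W.HasMultiplicativeReductionAtPrime ℓ ∧
      ¬ p ∣ padicValInt ℓ W.minimalDiscriminantInt)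
    (h : W.selmerCorank p = 1),
    W.analyticRank = 1

/-- The interim statement `analyticRank_eq_one_of_selmerCorank_eq_one` follows from
Burungale–Skinner–Tian–Wan, arXiv:2409.01350, Thm 1.10: its hypotheses are those of Thm 1.10 plus
`5 ≤ p` (which gives `p ≠ 2`) and the localisation hypothesis `hloc`, which is simply dropped.
[cite: BurungaleSkinnerTianWan2024, Thm. 1.10] -/
theorem analyticRank_eq_one_of_selmerCorank_eq_one_of_bstw
    (h : burungaleSkinnerTianWan_analyticRank_eq_one_of_selmerCorank_eq_one) :
    analyticRank_eq_one_of_selmerCorank_eq_one := by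
  intro W _ _ p _ hp hgood hord hsurj haux _ hcorank
  exact h W p (by omega) hgood hord hsurj haux hcorank

/-- **bsd.S25** (C.-H. Kim, *On the soft `p`-converse to a theorem of Gross–Zagier and Kolyvagin*,
Math. Ann. 387 (2022), 1961–1968 = arXiv:2109.12344, **Corollary 1.4**; the `p`-converse without
any hypothesis on the conductor, from the cyclotomic main conjecture inverting `p` and
Perrin-Riou's conjecture (Bertolini–Darmon–Venerucci)). Printed statement: "Let `E` be a non-CM
elliptic curve over `ℚ`. If `rk_ℤ E(ℚ) = 1` and `#Ш(E/ℚ)[p^∞] < ∞` for at least one good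
ordinary prime `p > 3` such that `E[p]` is irreducible, then `ord_{s=1} L(E,s) = 1`. In
particular, `#Ш(E/ℚ) < ∞`."
Transcription (globally minimal model `W`): non-CM = `¬ W.HasCM` (no geometric complex
multiplication); good ordinary `p > 3` = `3 < p`, `hgood`, `hord : p ∤ a_p(E)`; `E[p]` irreducible =
`W.HasIrreducibleModPGaloisRep p`; `rk_ℤ E(ℚ) = W.mordellWeilRank`;
`Ш(E/ℚ)[p^∞] = AddCommGroup.primaryComponent W.sha p`; both printed conclusions are recorded. [cite: Kim2022, Cor. 1.4] -/
def kim_analyticRank_eq_one_of_mordellWeilRank_eq_one : Prop :=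
  ∀ (W : WeierstrassCurve ℚ) [W.IsElliptic] [W.IsGloballyMinimal] (hcm : ¬ W.HasCM) (p : ℕ)
    [Fact p.Prime] (hp : 3 < p) (hgood : W.HasGoodReductionAtPrime p)
    (hord : ¬ (p : ℤ) ∣ W.frobeniusTrace p) (hirr : W.HasIrreducibleModPGaloisRep p)
    (hrank : W.mordellWeilRank = 1) (hsha : Finite ↥(AddCommGroup.primaryComponent W.sha p)),
    W.analyticRank = 1 ∧ Finite W.sha

end S25

/-! ## bsd.S26 — Bhargava–Shankar: the average size of the `2`-Selmer group -/

section S26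

/-- **bsd.S26** (M. Bhargava and A. Shankar, *Binary quartic forms having bounded invariants, and
the boundedness of the average rank of elliptic curves*, Ann. of Math. 181 (2015), Thm 1.1). When
elliptic curves `E_{A,B} : y² = x³ + Ax + B` over `ℚ` (one per isomorphism class,
`Literature.NumberTheory.EllipticCurves.IsInHeightFamily`) are ordered by naive height `H = max(4|A|³, 27B²)`, the average size of the
`2`-Selmer group `Sel^(2)(E/ℚ)` tends to `3`: `lim_{X → ∞} Avg_{H(E) < X} #Sel^(2)(E/ℚ) = 3`
(`Literature.NumberTheory.EllipticCurves.heightAverage` already averages over the curves of height `< X`). The average-rank clause of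
bsd.S26 (Thm 1.2, `≤ 1.5`; `0.885` by Bhargava–Shankar 2013) is tagged in `Statements/BSD/Wave0`. [cite: BhargavaShankarAnnals2015, Thm. 1.1] -/
def average_card_selmerTwo : Prop :=
  Tendsto (fun X ↦ heightAverage
      (fun AB ↦ (Nat.card ((shortWeierstrass AB).selmerGroup 2) : ℝ)) X) atTop (𝓝 3)

/-- **bsd.S26** (limsup form; Bhargava–Shankar, Ann. of Math. 181 (2015), Thm 1.1, which in fact
proves `limsup ≤ 3` for any family defined by finitely many congruence conditions). The average of
`#Sel^(2)(E/ℚ)` over curves of naive height `< X` is eventually `≤ 3 + ε` for every `ε > 0`. [cite: BhargavaShankarAnnals2015, Thm. 1.1 (and Thm. 1.3 for families defined by finitely many congruence conditions)] -/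
def heightAverageLE_card_selmerTwo : Prop :=
  HeightAverageLE (fun AB ↦ (Nat.card ((shortWeierstrass AB).selmerGroup 2) : ℝ)) 3

end S26

/-! ## bsd.S34 — Smith: `2^∞`-Selmer coranks in quadratic twist families -/

section S34

/-- `twistDensity P δ`: the set of squarefree integers `d` satisfying `P` has natural density `δ`
among all squarefree integers, ordered by `|d|`:
`#{d squarefree, |d| ≤ X, P d} / #{d squarefree, |d| ≤ X} → δ` as `X → ∞` (both signs of `d` are
counted; `d = 0` is not squarefree; for `X = 0` the quotient is the junk value `0/0 = 0`,
irrelevant to the limit). Smith, arXiv:2503.17619, §1 (densities in quadratic twist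
families). [cite: arXiv250317619] -/
def twistDensity (P : ℤ → Prop) (δ : ℝ) : Prop :=
  Tendsto (fun X : ℕ ↦ (Nat.card {d : ℤ | Squarefree d ∧ |d| ≤ X ∧ P d} : ℝ) /
    Nat.card {d : ℤ | Squarefree d ∧ |d| ≤ X}) atTop (𝓝 δ)

/-- The `ℤ₂`-corank of the `2^∞`-Selmer group `Sel_{2^∞}(E/ℚ)` of `W / ℚ`
(`Literature.zpCorank (W.selmerGroupPInfty 2) 2 = W.selmerCorank 2`). Smith, arXiv:2503.17619, §1. [cite: arXiv250317619] -/
def selmerCorankTwoInfty (W : WeierstrassCurve ℚ) : ℕ :=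
  zpCorank (W.selmerGroupPInfty 2) 2

/-- `selmerCorankTwoInfty` is the prelude's `selmerCorank` at `p = 2` (definitional). [folklore] -/
theorem selmerCorankTwoInfty_eq (W : WeierstrassCurve ℚ) :
    selmerCorankTwoInfty W = W.selmerCorank 2 :=
  rfl

variable (W : WeierstrassCurve ℚ) [W.IsElliptic]

/-- **bsd.S34** (A. Smith, *The Birch and Swinnerton-Dyer conjecture implies Goldfeld's
conjecture*, arXiv:2503.17619 (2025), **Thm 1.1**). For every elliptic curve `E/ℚ`, among the
quadratic twists `E^d` (`d` squarefree, ordered by `|d|`) the `2^∞`-Selmer corank is `0` for a set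
of `d` of density `1/2`, `1` for density `1/2`, and `≥ 2` (each `r ≥ 2`) for density `0`.
Hypothesis check (outline review 8): Thm 1.1 of arXiv:2503.17619 is stated for *every* elliptic
curve over `ℚ` — it removes the standing assumptions of the earlier versions (Smith,
arXiv:1702.02325, Thm 1.1: `E[2](ℚ) = (ℤ/2)²` and no rational cyclic `4`-isogeny; Smith,
arXiv:2207.05674: technical conditions incl. `E[2](ℚ) = 0`), so no extra hypothesis `hyp` is
carried; the `Isogeny` prelude is imported only to make that check expressible. `d ≠ 0` (needed for
`E^d = W.quadraticTwist d` to be elliptic) is part of the predicate. [cite: arXiv250317619] -/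
def smith_selmerCorank_density : Prop :=
  twistDensity (fun d ↦ d ≠ 0 ∧ selmerCorankTwoInfty (W.quadraticTwist d) = 0) (1 / 2) ∧
      twistDensity (fun d ↦ d ≠ 0 ∧ selmerCorankTwoInfty (W.quadraticTwist d) = 1) (1 / 2) ∧
        ∀ r : ℕ, 2 ≤ r →
          twistDensity (fun d ↦ d ≠ 0 ∧ selmerCorankTwoInfty (W.quadraticTwist d) = r) 0

/-- **bsd.S34** (A. Smith, arXiv:2503.17619 (2025), **Cor. 1.3**, from Thm 1.1 and `2`-parity
`(-1)^{corank Sel_{2^∞}} = w`, Dokchitser–Dokchitser 2010, together with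
`rank E^d(ℚ) ≤ corank Sel_{2^∞}(E^d/ℚ)`). For every elliptic curve `E/ℚ`: `100%` of the quadratic
twists `E^d` with root number `w(E^d) = +1` have rank `0`, and `100%` of those with `w(E^d) = −1`
have rank `≤ 1` (density `1` of the corresponding implication among all squarefree `d`). [cite: arXiv250317619, Cor. 1.3; DokchitserDokchitserAnnals2010, Thm. 1.4] -/
def smith_rank_of_rootNumber : Prop :=
  twistDensity (fun d ↦ d ≠ 0 → (W.quadraticTwist d).rootNumber = 1 →
        (W.quadraticTwist d).mordellWeilRank = 0) 1 ∧
      twistDensity (fun d ↦ d ≠ 0 → (W.quadraticTwist d).rootNumber = -1 →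
        (W.quadraticTwist d).mordellWeilRank ≤ 1) 1

end S34

end Literature.NumberTheory.EllipticCurves
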